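import Literature.Probability.LatticeModels.SixVertexGFFHeight
import Literature.LinearAlgebra.TensorNetworks.Basic

/-!
# The six-vertex model in finite volume: the vertex tensor, partition functions as tensor-network
# contractions, and the height-function model on discrete domains of `ℤ²`

Definition request `defn-SixVertexHeightModel` (route `CriticalPhenomena/CardyFormulaZ2`,
thesis `CardyTensorRG`, D1): *"six-vertex configurations on domains/tori of (the medial lattice
of) `ℤ²`, weights `(a, b, c)`, partition functions as `Literature.LinearAlgebra.TensorNetworks`
contractions, the height function, the infinite-volume measure at `a = b = 1`, `c ∈ [√3, 2]`, so
that DKLM's full-plane GFF theorem (`σ² = 2 / arccos Δ`) becomes statable."*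

## What already exists (do not redefine) — `Literature/Probability/LatticeModels/SixVertexGFF*.lean`

In the namespace `Literature.Probability.LatticeModels.SixVertex`:
arrow configurations `Config V = V → Bool × Bool` (east / north edge of each vertex), `inDegree`,
`IceRuleAt`, the local weight `vertexWeight a b c`, the torus weight `torusWeight` and the
balanced conditional torus measure `torusCondProb` / `torusCondProbNat` (DKLM Def. 2.1), the
planar slope-zero measure as a predicate `IsPlanarSixVertexMeasure` (DKLM Thm. 2.2), the height
function `heightAt` / `heightPlane` / `heightScaled` (DKLM §2.2, Def. 2.3) with its gradient
property (`heightAt_east`, `heightAt_north`), the correlation functions, `dklmSigma`, and the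
named fact `DKLM2026_sixVertex_heightFunction_GFF` (DKLM Thm. 2.8: the GFF limit for `a = b = 1`,
`√3 ≤ c ≤ 2`). The Baxter–Kelland–Wu dictionary with bond percolation (crossing probabilities
as six-vertex partition functions with boundary/twist tensors) is the separate request D2 and is
not touched here; this file only records that the medial lattice of `ℤ²` is a square lattice.

## What this file adds

* `anisotropy a b c = Δ = (a² + b² − c²)/(2ab)` (DKLM Def. 2.1, eq. for `Δ`), with
  `Δ(1,1,c) = 1 − c²/2`, `Δ(1,1,√3) = −1/2` (the percolation point of Baxter–Kelland–Wu),
  `arccos Δ(1,1,c) = 2 arcsin (c/2)` on `0 ≤ c ≤ 2`, hence DKLM's `σ² = 2/arccos Δ = dklmSigma c ^ 2`.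
* **The six-vertex tensor** `sixVertexTensor a b c : Bool → Bool → Bool → Bool → R` over any
  commutative semiring (legs: east, north, west, south arrow bits), *definitionally* the local
  weight: `vertexWeight a b c ω v = sixVertexTensor a b c (ω v).1 (ω v).2 (ω (v−e₁)).1 (ω (v−e₂)).2`.
* **The medial lattice of `ℤ²` is a square lattice**: `medialToSquare` / `medialEquiv` (edge
  midpoints of `ℤ²` `≃ ℤ × ℤ`, the rotation by `π/4` scaled by `√2`) and
  `medialToSquare_neighbours` (medial neighbours go to lattice neighbours), so that six-vertex
  configurations on domains / tori of the medial lattice are configurations on domains of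
  `ℤ × ℤ` / tori `ZMod M × ZMod L` as treated here and in `SixVertexGFF.lean`.
* **Edges and finite-volume configurations.** Edges of `G₁ × G₂` are `(u, false)` (horizontal,
  from `u` to `u + e₁`) and `(u, true)` (vertical, from `u` to `u + e₂`); `vertexEdges v`, the
  edges `edges V` incident to a finite vertex set `V` (DCKMO's `E(D)`), the `danglingEdges V`
  (exactly one endpoint in `V`: the open legs), finite configurations `↥(edges V) → ι` read through
  `EdgeConfig.val`, and the bijection `configEquiv : Config V ≃ (V × Bool → Bool)`.
* **Partition functions as tensor-network contractions** (Kennedy–Rychkov 2022, §1 and App. A: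
  "one first rewrites the partition function of a lattice model as a tensor network", a periodic
  arrangement of 4-index tensors whose full contraction is the partition function; here in the
  sum-of-products form `TensorNetwork` of `Literature.LinearAlgebra.TensorNetworks`):
  `gridNetwork V T β` — arbitrary 4-leg tensors `T v` at the vertices of `V`, arbitrary vectors
  `β e` closing the open legs — with `gridNetwork_value : (gridNetwork V T β).value = gridValue V T β`
  (the explicit finite sum); the six-vertex specialisation `partitionFunction a b c V β`,
  boundary vectors `pinned τ` (prescribed boundary arrows) and `free`, the formula
  `partitionFunction_pinned`, and on a finite torus `sum_torusWeight_eq_partitionFunction`: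
  `∑_ω W(ω) = partitionFunction a b c univ β` (no open legs: a closed network).
* **The six-vertex height-function model on a discrete domain** (Duminil-Copin–Karrila–
  Manolescu–Oulamara, §1.3): for a finite `V ⊂ ℤ²`, the domain `faces V` (faces with a corner
  in `V`, indexed by bottom-left corners), its boundary `bdryFaces V` (faces with a corner outside
  `V`), height functions `IsHeightFunctionOn V h` (`|h f − h f'| = 1` across every dual edge of
  the domain), the arrow configuration `arrowsOf h` of a height function and the relation
  `IsHeightOf V σ h` ("the face on the left of each arrow is one unit higher"), admissible
  boundary conditions `IsAdmissible V B ξ` (parity convention: the height of the face with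
  bottom-left corner `f` is `≡ f.1 + f.2 (mod 2)`, DKLM §2.2), the configuration set
  `heightConfigs V B ξ = Ω(D, ξ)`, the height function `heightOf V B ξ σ` of a configuration
  (with `heightOf_spec`), the weight, the partition function `heightModelZ` `= Z(D, ξ)`
  and the Gibbs measure **`sixVertexHeightModel a b c V B ξ = ℙ_D^ξ`** (a finitely supported
  `Measure` on `↥(edges V) → Bool`), with: the ice rule at every vertex of `V` for gradients of
  height functions (`inArrows_eq_two_of_isHeightOf`), `sixVertexHeightModel_real` (the printed
  formula `ℙ_D^ξ[A] = ∑_{ω ∈ A ∩ Ω(D,ξ)} W(ω) / Z(D,ξ)`), positivity of `Z(D, ξ)` and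
  `IsProbabilityMeasure` for admissible `ξ` and positive weights, and the bridge to DKLM's planar
  height function: `isHeightOf_configEquiv_heightAt` (the gradient of `heightAt ω` is `ω`, for
  every planar ice configuration).

## Faithfulness / design notes

* DCKMO take `V` connected and the support of `ξ` equal to `∂D` by default but explicitly allow
  other supports (footnote to §1.3); here `V` is any finite set and the support `B` is a
  parameter (`bdryFaces V` recovers `ℙ_D^ξ`). For non-admissible `ξ` the configuration set is
  empty and the measure is `0` (documented junk); `x / 0 = 0` makes every definition total.
* Weights are the symmetric ones `a₁ = a₂ = a`, `b₁ = b₂ = b`, `c₁ = c₂ = c` of the existing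
  files (DCKMO specialise further to `a = b = 1`). The ice-rule indicator is built into the
  tensor, and is automatic on `Ω(D, ξ)` (`inArrows_eq_two_of_isHeightOf`).
* Bond dimension: the grid network allows any finite leg type `ι` and coefficient semiring `R`
  (complex Baxter–Kelland–Wu phases, corner/twist tensors of the route live there); the six-vertex
  specialisation is `ι = Bool`. Nothing about RG maps is defined here (route object D3).
* Degenerate tori (`ZMod 1`) are allowed by the types; statements needing two distinct factors
  per edge (`TensorNetwork.IsClosed`) are not made.

## References

* H. Duminil-Copin, K. K. Kozlowski, P. Lammers, I. Manolescu, *Gaussian free field convergence of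
  the six-vertex model with `-1 ≤ Δ ≤ -1/2`*, arXiv:2603.06268 (2026), §2.1 Def. 2.1 (weights,
  `Δ`), §2.2 Def. 2.3 (height function). [DKLM2026SixVertexGFF]
* H. Duminil-Copin, A. Karrila, I. Manolescu, M. Oulamara, *Delocalization of the height function
  of the six-vertex model*, J. Eur. Math. Soc. (2024), arXiv:2012.13750, §1.2 (torus, height
  functions, arrows of a height function), §1.3 (discrete domains, `∂D`, admissible boundary
  conditions, `Ω(D, ξ)`, `ℙ_D^ξ`, `Z(D, ξ)`). [DuminilCopinKarrilaManolescuOulamara2024]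
* T. Kennedy, S. Rychkov, *Tensor RG approach to high-temperature fixed point*, J. Stat. Phys. 187
  (2022), arXiv:2107.11464, §1 and App. A (partition functions as contractions of a square-grid
  network of 4-tensors; periodic boundary conditions on a finite torus). [KennedyRychkov2022]
* R. J. Baxter, S. B. Kelland, F. Y. Wu, J. Phys. A 9 (1976) 397–406 (the percolation point
  `a = b = 1`, `c = √3`, `Δ = −1/2`; `Δ = −√q/2` in general). [BaxterKellandWu1976]
-/

noncomputable section

open MeasureTheory Finset
open scoped ENNReal

namespace Literature.Probability.LatticeModels.SixVertex

/-! ### The spectral parameter `Δ` -/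

/-- The **spectral (anisotropy) parameter** `Δ(a, b, c) = (a² + b² − c²) / (2ab)` of the
symmetric six-vertex weights. [cite: DKLM2026SixVertexGFF, Def. 2.1] -/
def anisotropy (a b c : ℝ) : ℝ :=
  (a ^ 2 + b ^ 2 - c ^ 2) / (2 * a * b)

/-- `Δ(1, 1, c) = 1 − c²/2`. [cite: DKLM2026SixVertexGFF, Def. 2.1] -/
theorem anisotropy_one_one (c : ℝ) : anisotropy 1 1 c = 1 - c ^ 2 / 2 := by
  unfold anisotropy
  ring

/-- The percolation point: `Δ(1, 1, √3) = −1/2` (under the Baxter–Kelland–Wu correspondence the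
critical random-cluster weights `q ∈ [1, 4]` match `c ∈ [√3, 2]`, `q = 1` being `c = √3`). [cite: DKLM2026SixVertexGFF, §4.2] -/
theorem anisotropy_one_one_sqrt_three : anisotropy 1 1 (Real.sqrt 3) = -1 / 2 := by
  rw [anisotropy_one_one, Real.sq_sqrt (by norm_num)]
  norm_num

/-- The Baxter–Kelland–Wu parametrisation `√q = −2Δ`: at `c = √(2 + √q)` one has
`Δ(1, 1, c) = −√q / 2` (so `q ∈ [1, 4] ↔ c ∈ [√3, 2]`, DKLM §4.2). [folklore] -/
theorem anisotropy_one_one_sqrt_two_add_sqrt (q : ℝ) :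
    anisotropy 1 1 (Real.sqrt (2 + Real.sqrt q)) = -Real.sqrt q / 2 := by
  rw [anisotropy_one_one, Real.sq_sqrt (by positivity)]
  ring

/-- For `a = b = 1` and `0 ≤ c ≤ 2`: `arccos Δ = 2 arcsin (c/2)` (with `c = 2 sin θ`,
`Δ = cos 2θ`). [cite: DKLM2026SixVertexGFF, Thm. 2.8] -/
theorem arccos_anisotropy_one_one {c : ℝ} (h0 : 0 ≤ c) (h2 : c ≤ 2) :
    Real.arccos (anisotropy 1 1 c) = 2 * Real.arcsin (c / 2) := by
  set θ := Real.arcsin (c / 2) with hθ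
  have hs : Real.sin θ = c / 2 := Real.sin_arcsin (by linarith) (by linarith)
  have hθ0 : 0 ≤ θ := Real.arcsin_nonneg.mpr (by linarith)
  have hθ1 : θ ≤ Real.pi / 2 := Real.arcsin_le_pi_div_two _
  have hcos : Real.cos (2 * θ) = anisotropy 1 1 c := by
    rw [anisotropy_one_one, Real.cos_two_mul, Real.cos_sq', hs]
    ring
  rw [← hcos, Real.arccos_cos (by linarith) (by linarith)]

/-- DKLM's normalisation `σ² = 2 / arccos Δ` equals `1 / arcsin (c/2) = dklmSigma c ^ 2` for
`a = b = 1`, `0 ≤ c ≤ 2`. [cite: DKLM2026SixVertexGFF, Thm. 2.8] -/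
theorem two_div_arccos_anisotropy {c : ℝ} (h0 : 0 ≤ c) (h2 : c ≤ 2) :
    2 / Real.arccos (anisotropy 1 1 c) = dklmSigma c ^ 2 := by
  rw [arccos_anisotropy_one_one h0 h2, dklmSigma_sq (Real.arcsin_nonneg.mpr (by linarith)),
    div_mul_eq_div_div]
  norm_num

/-! ### The six-vertex tensor -/

section Tensor

variable {R : Type*} [CommSemiring R]

/-- Number of arrows pointing into a vertex, from the four arrow bits of its east, north, west
and south edges (`true` = the edge points east, resp. north): the east edge contributes iff it
points west, the west edge iff it points east, the north edge iff it points south, the south edge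
iff it points north. This is `inDegree` read off the four bits. [cite: DKLM2026SixVertexGFF, §2.1] -/
def inArrows (e n w s : Bool) : ℕ :=
  (if e then 0 else 1) + (if w then 1 else 0) + (if n then 0 else 1) + (if s then 1 else 0)

/-- The **six-vertex tensor** `W(a, b, c)`: the rank-4 tensor with two-valued legs (east, north,
west, south arrow bits) whose entry is the local Boltzmann weight — `0` off the ice rule, `a` for
types 1–2 (arrows pass straight through, `→→↑↑` / `←←↓↓`: east and north bits equal), `b` for
types 3–4 (straight through, `→→↓↓` / `←←↑↑`: east and north bits different), `c` for types 5–6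
(the two horizontal arrows point in opposite directions, hence so do the vertical ones).
Contracting these tensors along the edges of the lattice gives the partition function (below).
[cite: DKLM2026SixVertexGFF, Def. 2.1] -/
def sixVertexTensor (a b c : R) (e n w s : Bool) : R :=
  if inArrows e n w s = 2 then (if w = e then (if e = n then a else b) else c) else 0

/-- The local weight of the existing development IS the six-vertex tensor read on the four edges
at `v` (definitionally). [cite: DKLM2026SixVertexGFF, Def. 2.1] -/
theorem vertexWeight_eq_sixVertexTensor {G₁ G₂ : Type*} [AddGroup G₁] [AddGroup G₂] [One G₁]
    [One G₂] (a b c : ℝ) (ω : Config (G₁ × G₂)) (v : G₁ × G₂) :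
    vertexWeight a b c ω v =
      sixVertexTensor a b c (ω v).1 (ω v).2 (ω (v.1 - 1, v.2)).1 (ω (v.1, v.2 - 1)).2 :=
  rfl

/-- Arrow-reversal symmetry of the symmetric weights: flipping all four legs preserves the
entry (`a₁ = a₂`, `b₁ = b₂`, `c₁ = c₂`). [cite: DKLM2026SixVertexGFF, Def. 2.1] -/
theorem sixVertexTensor_not (a b c : R) (e n w s : Bool) :
    sixVertexTensor a b c (!e) (!n) (!w) (!s) = sixVertexTensor a b c e n w s := by
  cases e <;> cases n <;> cases w <;> cases s <;> simp [sixVertexTensor, inArrows]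

/-- The tensor vanishes off the ice rule. [cite: DKLM2026SixVertexGFF, Def. 2.1] -/
theorem sixVertexTensor_of_ne (a b c : R) {e n w s : Bool} (h : inArrows e n w s ≠ 2) :
    sixVertexTensor a b c e n w s = 0 := by
  simp [sixVertexTensor, h]

/-- Nonnegative weights give a nonnegative tensor. [folklore] -/
theorem sixVertexTensor_nonneg {a b c : ℝ} (ha : 0 ≤ a) (hb : 0 ≤ b) (hc : 0 ≤ c)
    (e n w s : Bool) : 0 ≤ sixVertexTensor a b c e n w s := by
  unfold sixVertexTensor
  split_ifs <;> first | assumption | exact le_rfl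

/-- Positive weights give a positive entry at every ice-rule vertex. [folklore] -/
theorem sixVertexTensor_pos {a b c : ℝ} (ha : 0 < a) (hb : 0 < b) (hc : 0 < c)
    {e n w s : Bool} (h : inArrows e n w s = 2) : 0 < sixVertexTensor a b c e n w s := by
  unfold sixVertexTensor
  rw [if_pos h]
  split_ifs <;> assumption

end Tensor

/-! ### Edges of the square lattice and finite-volume configurations -/

section Edges

variable {G₁ G₂ : Type*} [AddGroup G₁] [AddGroup G₂] [One G₁] [One G₂]

/-- The far endpoint of an edge: `(u, false)` is the horizontal edge from `u` to `u + e₁`,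
`(u, true)` the vertical edge from `u` to `u + e₂`. [folklore] -/
def edgeTip (e : (G₁ × G₂) × Bool) : G₁ × G₂ :=
  if e.2 then (e.1.1, e.1.2 + 1) else (e.1.1 + 1, e.1.2)

variable [DecidableEq G₁] [DecidableEq G₂]

/-- The four edges at a vertex `v`: east `(v, false)`, north `(v, true)`, west `(v − e₁, false)`,
south `(v − e₂, true)` — the edges read by `vertexWeight … v`. [folklore] -/
def vertexEdges (v : G₁ × G₂) : Finset ((G₁ × G₂) × Bool) :=
  {(v, false), (v, true), ((v.1 - 1, v.2), false), ((v.1, v.2 - 1), true)}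

/-- The edges incident to a finite vertex set `V` (DCKMO's `E = E(D)`: "let `E` be the edges
incident to them"). [cite: DuminilCopinKarrilaManolescuOulamara2024, §1.3] -/
def edges (V : Finset (G₁ × G₂)) : Finset ((G₁ × G₂) × Bool) :=
  V.biUnion vertexEdges

/-- The edges of `V` with an endpoint outside `V` — the open legs of the network on `V`. [folklore] -/
def danglingEdges (V : Finset (G₁ × G₂)) : Finset ((G₁ × G₂) × Bool) :=
  (edges V).filter fun e => ¬(e.1 ∈ V ∧ edgeTip e ∈ V)

/-- The edges at a vertex of `V` are edges of `E(V)`. [folklore] -/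
theorem mem_edges_of_mem {V : Finset (G₁ × G₂)} {v : G₁ × G₂} (hv : v ∈ V)
    {e : (G₁ × G₂) × Bool} (he : e ∈ vertexEdges v) : e ∈ edges V :=
  Finset.mem_biUnion.mpr ⟨v, hv, he⟩

omit [DecidableEq G₁] [DecidableEq G₂] in
/-- An edge lies at the vertex `v` iff `v` is one of its two endpoints. [folklore] -/
theorem mem_vertexEdges_iff [DecidableEq G₁] [DecidableEq G₂] (v : G₁ × G₂)
    (e : (G₁ × G₂) × Bool) : e ∈ vertexEdges v ↔ e.1 = v ∨ edgeTip e = v := by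
  obtain ⟨⟨x, y⟩, d⟩ := e
  obtain ⟨p, q⟩ := v
  cases d <;>
    simp only [vertexEdges, edgeTip, Finset.mem_insert, Finset.mem_singleton, Prod.mk.injEq,
      Bool.false_eq_true, Bool.true_eq_false, and_false, and_true, or_false, false_or,
      if_true, if_false] <;>
    constructor <;> rintro (⟨rfl, rfl⟩ | ⟨rfl, rfl⟩) <;> simp

/-- `e ∈ edges V` iff one of its endpoints lies in `V`. [cite: DuminilCopinKarrilaManolescuOulamara2024, §1.3] -/
theorem mem_edges_iff (V : Finset (G₁ × G₂)) (e : (G₁ × G₂) × Bool) :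
    e ∈ edges V ↔ e.1 ∈ V ∨ edgeTip e ∈ V := by
  simp only [edges, Finset.mem_biUnion, mem_vertexEdges_iff]
  constructor
  · rintro ⟨v, hv, rfl | rfl⟩
    · exact Or.inl hv
    · exact Or.inr hv
  · rintro (h | h)
    · exact ⟨_, h, Or.inl rfl⟩
    · exact ⟨_, h, Or.inr rfl⟩

/-- Reading a finite-volume leg assignment `σ : edges V → ι` at an arbitrary edge (junk
`default` off `edges V`; never met at the edges of a vertex of `V`). [folklore] -/
def EdgeConfig.val {ι : Type*} [Inhabited ι] {V : Finset (G₁ × G₂)} (σ : ↥(edges V) → ι)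
    (e : (G₁ × G₂) × Bool) : ι :=
  if h : e ∈ edges V then σ ⟨e, h⟩ else default

/-- On `edges V` the reading is the assignment itself. [folklore] -/
theorem EdgeConfig.val_of_mem {ι : Type*} [Inhabited ι] {V : Finset (G₁ × G₂)}
    (σ : ↥(edges V) → ι) {e : (G₁ × G₂) × Bool} (h : e ∈ edges V) :
    EdgeConfig.val σ e = σ ⟨e, h⟩ := by
  simp [EdgeConfig.val, h]

/-- Two assignments agreeing at `e` (if `e ∈ edges V`) read the same value at `e`. [folklore] -/
theorem EdgeConfig.val_congr {ι : Type*} [Inhabited ι] {V : Finset (G₁ × G₂)}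
    {σ σ' : ↥(edges V) → ι} {e : (G₁ × G₂) × Bool}
    (h : ∀ he : e ∈ edges V, σ ⟨e, he⟩ = σ' ⟨e, he⟩) :
    EdgeConfig.val σ e = EdgeConfig.val σ' e := by
  unfold EdgeConfig.val
  split_ifs with he
  · exact h he
  · rfl

end Edges

/-- The arrow bits of a configuration read by edges: `(u, false) ↦` east bit of `u`,
`(u, true) ↦` north bit of `u`. [folklore] -/
def edgeBits {V : Type*} (ω : Config V) (e : V × Bool) : Bool :=
  if e.2 then (ω e.1).2 else (ω e.1).1

/-- `Config V = (V → Bool × Bool)` and edge functions `V × Bool → Bool` are the same data. [folklore] -/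
def configEquiv (V : Type*) : Config V ≃ (V × Bool → Bool) where
  toFun := edgeBits
  invFun σ v := (σ (v, false), σ (v, true))
  left_inv ω := by
    funext v
    simp [edgeBits]
  right_inv σ := by
    funext ⟨v, d⟩
    cases d <;> simp [edgeBits]

/-- `configEquiv` reads the east bit on horizontal edges. [folklore] -/
@[simp] theorem configEquiv_apply_false {V : Type*} (ω : Config V) (u : V) :
    configEquiv V ω (u, false) = (ω u).1 := rfl

/-- `configEquiv` reads the north bit on vertical edges. [folklore] -/
@[simp] theorem configEquiv_apply_true {V : Type*} (ω : Config V) (u : V) :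
    configEquiv V ω (u, true) = (ω u).2 := rfl

/-! ### The medial lattice of `ℤ²` is a square lattice -/

/-- The vertices of the **medial lattice** of `ℤ²` are the midpoints of the edges of `ℤ²`, i.e.
the edges `(u, d)` themselves; two of them are joined by a medial edge iff the two edges of `ℤ²`
are perpendicular at a common endpoint (consecutive around it). Rotating by `π/4` and scaling by
`√2` identifies this graph with `ℤ²`: the horizontal edge from `(x, y)` (midpoint `(x + ½, y)`)
goes to `(x + y, y − x)`, the vertical edge from `(x, y)` (midpoint `(x, y + ½)`) to
`(x + y, y − x + 1)`. Six-vertex configurations "on a domain of the medial lattice" (arrows on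
medial edges, ice rule at the midpoints) are thereby configurations on the image domain of
`ℤ × ℤ`, to which everything below applies. [folklore] -/
def medialToSquare : (ℤ × ℤ) × Bool → ℤ × ℤ
  | ((x, y), false) => (x + y, y - x)
  | ((x, y), true) => (x + y, y - x + 1)

/-- The inverse identification: a point `(m, n)` of `ℤ²` with `m + n` even is the horizontal edge
from `((m − n)/2, (m + n)/2)`, with `m + n` odd the vertical edge from `((m − n + 1)/2, (m + n − 1)/2)`. [folklore] -/
def squareToMedial (m : ℤ × ℤ) : (ℤ × ℤ) × Bool :=
  if (m.1 + m.2) % 2 = 0 then (((m.1 - m.2) / 2, (m.1 + m.2) / 2), false)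
  else (((m.1 - m.2 + 1) / 2, (m.1 + m.2 - 1) / 2), true)

/-- The medial lattice of `ℤ²` and `ℤ²` have the same vertex sets under `medialToSquare`. [folklore] -/
def medialEquiv : (ℤ × ℤ) × Bool ≃ ℤ × ℤ where
  toFun := medialToSquare
  invFun := squareToMedial
  left_inv := by
    rintro ⟨⟨x, y⟩, d⟩
    cases d
    · simp only [medialToSquare, squareToMedial]
      rw [if_pos (by omega)]
      congr 2 <;> omega
    · simp only [medialToSquare, squareToMedial]
      rw [if_neg (by omega)]
      congr 2 <;> omega
  right_inv := by
    rintro ⟨m, n⟩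
    simp only [squareToMedial]
    split_ifs with h
    · simp only [medialToSquare, Prod.mk.injEq]
      omega
    · simp only [medialToSquare, Prod.mk.injEq]
      omega

/-- **The identification is a graph isomorphism**: the four medial neighbours of the horizontal
edge from `(x, y)` — the vertical edges from `(x, y)`, `(x + 1, y)`, `(x, y − 1)`, `(x + 1, y − 1)`,
perpendicular to it at one of its endpoints — go to the four lattice neighbours of its image, and
likewise the four medial neighbours of the vertical edge from `(x, y)` — the horizontal edges from
`(x, y + 1)`, `(x, y)`, `(x − 1, y + 1)`, `(x − 1, y)`. [folklore] -/
theorem medialToSquare_neighbours (x y : ℤ) :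
    medialToSquare ((x, y), true) = medialToSquare ((x, y), false) + (0, 1) ∧
    medialToSquare ((x + 1, y), true) = medialToSquare ((x, y), false) + (1, 0) ∧
    medialToSquare ((x, y - 1), true) = medialToSquare ((x, y), false) + (-1, 0) ∧
    medialToSquare ((x + 1, y - 1), true) = medialToSquare ((x, y), false) + (0, -1) ∧
    medialToSquare ((x, y + 1), false) = medialToSquare ((x, y), true) + (1, 0) ∧
    medialToSquare ((x, y), false) = medialToSquare ((x, y), true) + (0, -1) ∧
    medialToSquare ((x - 1, y + 1), false) = medialToSquare ((x, y), true) + (0, 1) ∧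
    medialToSquare ((x - 1, y), false) = medialToSquare ((x, y), true) + (-1, 0) := by
  simp only [medialToSquare, Prod.mk_add_mk, Prod.mk.injEq]
  ring_nf
  simp

/-! ### Square-grid tensor networks with open legs closed by vectors; partition functions -/

section Grid

variable {R : Type*} [CommSemiring R] {ι : Type*} [Inhabited ι]
variable {G₁ G₂ : Type*} [AddGroup G₁] [AddGroup G₂] [One G₁] [One G₂]
  [DecidableEq G₁] [DecidableEq G₂]

/-- The entry of the 4-leg tensor `T v` on the legs of `v` (east, north, west, south) under the
leg assignment `σ`. [cite: KennedyRychkov2022, §1] -/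
def vertexEntry (T : G₁ × G₂ → ι → ι → ι → ι → R) {V : Finset (G₁ × G₂)}
    (σ : ↥(edges V) → ι) (v : G₁ × G₂) : R :=
  T v (EdgeConfig.val σ (v, false)) (EdgeConfig.val σ (v, true))
    (EdgeConfig.val σ ((v.1 - 1, v.2), false)) (EdgeConfig.val σ ((v.1, v.2 - 1), true))

/-- The summand of the contraction: product of the vertex entries over `V` times the product of
the closing vectors `β e` over the open legs. [cite: KennedyRychkov2022, §1] -/
def gridWeight (V : Finset (G₁ × G₂)) (T : G₁ × G₂ → ι → ι → ι → ι → R)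
    (β : (G₁ × G₂) × Bool → ι → R) (σ : ↥(edges V) → ι) : R :=
  (∏ v ∈ V, vertexEntry T σ v) * ∏ e ∈ danglingEdges V, β e (EdgeConfig.val σ e)

/-- The full contraction `∑_σ ∏_v T_v(σ) ∏_{e open} β_e(σ_e)` of the square-grid network on `V`
with vertex tensors `T` and leg-closing vectors `β`, as an explicit finite sum (every leg ranges
over the finite index type `ι`). [cite: KennedyRychkov2022, §1] -/
def gridValue [Fintype ι] (V : Finset (G₁ × G₂)) (T : G₁ × G₂ → ι → ι → ι → ι → R)
    (β : (G₁ × G₂) × Bool → ι → R) : R :=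
  ∑ σ : ↥(edges V) → ι, gridWeight V T β σ

/-- **The square-grid tensor network on `V`** in the sum-of-products form of
`Literature.LinearAlgebra.TensorNetworks`: variables = the edges incident to `V` (legs, values in
`ι`), one factor per vertex of `V` carrying its four legs with entries `T v`, and one rank-1 factor
per open leg with entries `β e` (Kennedy–Rychkov: "a tensor network is a periodic arrangement of
tensors, with links indicating which tensor indices have to be contracted"; here an arbitrary
finite piece of the square grid, the cut links closed by vectors). [cite: KennedyRychkov2022, §1] -/
def gridNetwork (V : Finset (G₁ × G₂)) (T : G₁ × G₂ → ι → ι → ι → ι → R)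
    (β : (G₁ × G₂) × Bool → ι → R) :
    LinearAlgebra.TensorNetworks.TensorNetwork R ↥(edges V) ι (↥V ⊕ ↥(danglingEdges V)) where
  scope
    | Sum.inl v => Finset.univ.filter fun x => x.1 ∈ vertexEdges (v : G₁ × G₂)
    | Sum.inr e => Finset.univ.filter fun x => x.1 = (e : (G₁ × G₂) × Bool)
  entry
    | Sum.inl v => fun σ => vertexEntry T σ v
    | Sum.inr e => fun σ => β e (EdgeConfig.val σ e)
  entry_congr := by
    rintro (v | e) σ σ' h
    · have key : ∀ e' ∈ vertexEdges (v : G₁ × G₂), EdgeConfig.val σ e' = EdgeConfig.val σ' e' :=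
        fun e' he' => EdgeConfig.val_congr fun he => h ⟨e', he⟩ (by simpa using he')
      simp only [vertexEntry]
      rw [key (↑v, false) (by simp [vertexEdges]), key (↑v, true) (by simp [vertexEdges]),
        key (((v : G₁ × G₂).1 - 1, (v : G₁ × G₂).2), false) (by simp [vertexEdges]),
        key (((v : G₁ × G₂).1, (v : G₁ × G₂).2 - 1), true) (by simp [vertexEdges])]
    · exact congrArg (β e) (EdgeConfig.val_congr fun he => h ⟨e, he⟩ (by simp))

/-- **The value of the grid network is the explicit contraction sum.** [cite: KennedyRychkov2022, §1] -/
theorem gridNetwork_value [Fintype ι] (V : Finset (G₁ × G₂)) (T : G₁ × G₂ → ι → ι → ι → ι → R)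
    (β : (G₁ × G₂) × Bool → ι → R) : (gridNetwork V T β).value = gridValue V T β := by
  simp only [LinearAlgebra.TensorNetworks.TensorNetwork.value, gridValue, gridWeight,
    Fintype.prod_sum_type]
  refine Finset.sum_congr rfl fun σ _ => ?_
  rw [← Finset.prod_coe_sort V, ← Finset.prod_coe_sort (danglingEdges V)]
  rfl

/-- **The six-vertex partition function of the finite piece `V`** with leg-closing (boundary)
vectors `β`: `Z_V[β] = ∑_σ ∏_{v ∈ V} W(a,b,c)_v(σ) · ∏_{e open} β_e(σ_e)`, the sum over arrow
configurations of the edges incident to `V`. [cite: KennedyRychkov2022, §1] -/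
def partitionFunction (a b c : R) (V : Finset (G₁ × G₂)) (β : (G₁ × G₂) × Bool → Bool → R) : R :=
  gridValue V (fun _ => sixVertexTensor a b c) β

/-- The six-vertex network: the grid network with the tensor `W(a, b, c)` at every vertex. [cite: KennedyRychkov2022, §1] -/
abbrev sixVertexNetwork (a b c : R) (V : Finset (G₁ × G₂)) (β : (G₁ × G₂) × Bool → Bool → R) :=
  gridNetwork V (fun _ => sixVertexTensor a b c) β

/-- The six-vertex partition function is the value (full contraction) of the six-vertex tensor
network. [cite: KennedyRychkov2022, §1] -/
theorem sixVertexNetwork_value (a b c : R) (V : Finset (G₁ × G₂))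
    (β : (G₁ × G₂) × Bool → Bool → R) :
    (sixVertexNetwork a b c V β).value = partitionFunction a b c V β :=
  gridNetwork_value V _ β

/-- Boundary vectors prescribing the arrow `τ e` on each open leg (fixed boundary arrows). [folklore] -/
def pinned (τ : (G₁ × G₂) × Bool → Bool) : (G₁ × G₂) × Bool → Bool → R :=
  fun e s => if s = τ e then 1 else 0

/-- Free boundary vectors: every open leg is summed over both arrow values with weight `1`. [folklore] -/
def free : (G₁ × G₂) × Bool → Bool → R :=
  fun _ _ => 1

/-- With pinned boundary arrows the partition function is the sum, over the configurations that
agree with `τ` on the open legs, of the product of the vertex weights. [folklore] -/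
theorem partitionFunction_pinned (a b c : R) (V : Finset (G₁ × G₂)) (τ : (G₁ × G₂) × Bool → Bool) :
    partitionFunction a b c V (pinned τ) =
      ∑ σ ∈ Finset.univ.filter
          (fun σ : ↥(edges V) → Bool => ∀ e ∈ danglingEdges V, EdgeConfig.val σ e = τ e),
        ∏ v ∈ V, vertexEntry (fun _ => sixVertexTensor a b c) σ v := by
  simp only [partitionFunction, gridValue, gridWeight, pinned, Finset.prod_boole, mul_boole,
    Finset.sum_filter]

/-- With free boundary vectors the partition function is the plain sum of the vertex-weight
products over all configurations of the incident edges. [folklore] -/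
theorem partitionFunction_free (a b c : R) (V : Finset (G₁ × G₂)) :
    partitionFunction a b c V free =
      ∑ σ : ↥(edges V) → Bool, ∏ v ∈ V, vertexEntry (fun _ => sixVertexTensor a b c) σ v := by
  simp [partitionFunction, gridValue, gridWeight, free]

/-! #### The finite torus: a closed network -/

omit [DecidableEq G₁] [DecidableEq G₂] in
/-- Every edge of a finite torus is incident to the full vertex set. [folklore] -/
theorem mem_edges_univ [Fintype G₁] [Fintype G₂] [DecidableEq G₁] [DecidableEq G₂]
    (e : (G₁ × G₂) × Bool) : e ∈ edges (Finset.univ : Finset (G₁ × G₂)) :=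
  (mem_edges_iff _ e).mpr (Or.inl (Finset.mem_univ _))

/-- On the full torus there are no open legs. [folklore] -/
theorem danglingEdges_univ [Fintype G₁] [Fintype G₂] :
    danglingEdges (Finset.univ : Finset (G₁ × G₂)) = ∅ := by
  simp [danglingEdges]

/-- **The torus partition function is a closed tensor-network contraction**: for the finite torus
`G₁ × G₂` (e.g. `ZMod M × ZMod L`), `∑_ω W(ω)` — the normalisation `Z_{𝕋}` of the torus Gibbs
measure of Def. 2.1 — equals the value of the six-vertex network on all vertices, whatever the
(unused) boundary vectors (Kennedy–Rychkov App. A: "in finite volume this gives the partition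
function with periodic boundary conditions"). [cite: KennedyRychkov2022, App. A] -/
theorem sum_torusWeight_eq_partitionFunction [Fintype G₁] [Fintype G₂] (a b c : ℝ)
    (β : (G₁ × G₂) × Bool → Bool → ℝ) :
    ∑ ω : Config (G₁ × G₂), torusWeight a b c ω = partitionFunction a b c Finset.univ β := by
  classical
  -- identify leg assignments on `edges univ` with edge functions, then with `Config`
  let E : ↥(edges (Finset.univ : Finset (G₁ × G₂))) ≃ (G₁ × G₂) × Bool :=
    Equiv.subtypeUnivEquiv mem_edges_univ
  let Φ : (↥(edges (Finset.univ : Finset (G₁ × G₂))) → Bool) ≃ Config (G₁ × G₂) :=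
    (Equiv.arrowCongr E (Equiv.refl Bool)).trans (configEquiv (G₁ × G₂)).symm
  have hval : ∀ (σ : ↥(edges (Finset.univ : Finset (G₁ × G₂))) → Bool) (e : (G₁ × G₂) × Bool),
      EdgeConfig.val σ e = configEquiv (G₁ × G₂) (Φ σ) e := by
    intro σ e
    rw [EdgeConfig.val_of_mem σ (mem_edges_univ e)]
    simp [Φ, E, Equiv.arrowCongr, Equiv.subtypeUnivEquiv]
  simp only [partitionFunction, gridValue, gridWeight, danglingEdges_univ, Finset.prod_empty,
    mul_one]
  refine (Fintype.sum_equiv Φ.symm _ _ fun ω => ?_)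
  simp only [torusWeight, vertexEntry]
  refine Finset.prod_congr rfl fun v _ => ?_
  rw [vertexWeight_eq_sixVertexTensor, hval, hval, hval, hval, Equiv.apply_symm_apply]
  rfl

end Grid

/-! ### Discrete domains of `ℤ²` and the six-vertex height-function model (DCKMO §1.3) -/

section HeightModel

/-- The four faces having `v` as a corner, each face indexed by its bottom-left corner. [folklore] -/
def vertexFaces (v : ℤ × ℤ) : Finset (ℤ × ℤ) :=
  {v, (v.1 - 1, v.2), (v.1, v.2 - 1), (v.1 - 1, v.2 - 1)}

/-- The four corners of the face with bottom-left corner `f`. [folklore] -/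
def faceCorners (f : ℤ × ℤ) : Finset (ℤ × ℤ) :=
  {f, (f.1 + 1, f.2), (f.1, f.2 + 1), (f.1 + 1, f.2 + 1)}

/-- The **discrete domain** `D = D(V)`: the faces of `ℤ²` with at least one corner in `V`
(faces indexed by bottom-left corners). [cite: DuminilCopinKarrilaManolescuOulamara2024, §1.3] -/
def faces (V : Finset (ℤ × ℤ)) : Finset (ℤ × ℤ) :=
  V.biUnion vertexFaces

/-- The **boundary** `∂D`: the faces of `D` with at least one corner not in `V`. [cite: DuminilCopinKarrilaManolescuOulamara2024, §1.3] -/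
def bdryFaces (V : Finset (ℤ × ℤ)) : Finset (ℤ × ℤ) :=
  (faces V).filter fun f => ¬(faceCorners f ⊆ V)

/-- The face on the **left** of the arrow carried by the edge `e` with arrow bit `s`: for the
horizontal edge `(u, false)` the faces above (`u`) and below (`u − e₂`) it, the upper one being on
the left of an east-pointing arrow; for the vertical edge `(u, true)` the faces east (`u`) and
west (`u − e₁`) of it, the western one being on the left of a north-pointing arrow. [cite: DuminilCopinKarrilaManolescuOulamara2024, §1.2] -/
def leftFace (e : (ℤ × ℤ) × Bool) (s : Bool) : ℤ × ℤ :=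
  match e.2, s with
  | false, true => e.1
  | false, false => (e.1.1, e.1.2 - 1)
  | true, true => (e.1.1 - 1, e.1.2)
  | true, false => e.1

/-- The face on the **right** of the arrow: the left face of the reversed arrow. [cite: DuminilCopinKarrilaManolescuOulamara2024, §1.2] -/
def rightFace (e : (ℤ × ℤ) × Bool) (s : Bool) : ℤ × ℤ :=
  leftFace e (!s)

/-- `h` is a height function on `D(V)` **associated with** the arrow configuration `σ`: across
every edge of `E(V)` "the height of the face on the left of each arrow is one unit higher than
the height of that on its right". [cite: DuminilCopinKarrilaManolescuOulamara2024, §1.2] -/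
def IsHeightOf (V : Finset (ℤ × ℤ)) (σ : (ℤ × ℤ) × Bool → Bool) (h : ℤ × ℤ → ℤ) : Prop :=
  ∀ e ∈ edges V, h (leftFace e (σ e)) = h (rightFace e (σ e)) + 1

/-- `h` is a **height function on the domain `D(V)`**: a graph homomorphism to `ℤ` on the dual
graph of `D` — the heights of the two faces bordering any edge of `E(V)` differ by exactly one.
(Values of `h` off `faces V` are irrelevant.) [cite: DuminilCopinKarrilaManolescuOulamara2024, §1.3] -/
def IsHeightFunctionOn (V : Finset (ℤ × ℤ)) (h : ℤ × ℤ → ℤ) : Prop :=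
  ∀ e ∈ edges V, h (leftFace e true) = h (leftFace e false) + 1 ∨
    h (leftFace e false) = h (leftFace e true) + 1

/-- The arrow configuration of a height function: orient each edge so that the face on its left
is the higher one. [cite: DuminilCopinKarrilaManolescuOulamara2024, §1.2] -/
def arrowsOf (h : ℤ × ℤ → ℤ) (e : (ℤ × ℤ) × Bool) : Bool :=
  decide (h (leftFace e true) = h (leftFace e false) + 1)

/-- A height function is associated with its own arrow configuration. [cite: DuminilCopinKarrilaManolescuOulamara2024, §1.2] -/
theorem IsHeightFunctionOn.isHeightOf_arrowsOf {V : Finset (ℤ × ℤ)} {h : ℤ × ℤ → ℤ}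
    (hh : IsHeightFunctionOn V h) : IsHeightOf V (arrowsOf h) h := by
  intro e he
  rcases hh e he with h1 | h1
  · have : arrowsOf h e = true := by simp [arrowsOf, h1]
    simpa [rightFace, this] using h1
  · have : arrowsOf h e = false := by
      simp only [arrowsOf, decide_eq_false_iff_not]
      omega
    simpa [rightFace, this] using h1

/-- Conversely the height function of an arrow configuration is a height function on the domain. [cite: DuminilCopinKarrilaManolescuOulamara2024, §1.3] -/
theorem IsHeightOf.isHeightFunctionOn {V : Finset (ℤ × ℤ)} {σ : (ℤ × ℤ) × Bool → Bool}
    {h : ℤ × ℤ → ℤ} (hσ : IsHeightOf V σ h) : IsHeightFunctionOn V h := by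
  intro e he
  have h1 := hσ e he
  simp only [rightFace] at h1
  cases hs : σ e
  · rw [hs] at h1
    exact Or.inr (by simpa using h1)
  · rw [hs] at h1
    exact Or.inl (by simpa using h1)

/-- The parity convention for height functions: the face with bottom-left corner `f = (x, y)`
carries a height `≡ x + y (mod 2)` (the face north-east of the origin is even, DKLM §2.2; DCKMO's
"odd on odd faces and even on even faces"). [cite: DKLM2026SixVertexGFF, §2.2] -/
def HasFaceParity (h : ℤ × ℤ → ℤ) (f : ℤ × ℤ) : Prop :=
  (h f : ZMod 2) = ((f.1 + f.2 : ℤ) : ZMod 2)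

/-- An **admissible boundary condition** `ξ` on the support `B` (`B = bdryFaces V = ∂D` for the
printed notion; other supports are allowed in the source's footnote): some height function on
`D(V)` with the parity convention restricts to `ξ` on `B`. [cite: DuminilCopinKarrilaManolescuOulamara2024, §1.3] -/
def IsAdmissible (V B : Finset (ℤ × ℤ)) (ξ : ℤ × ℤ → ℤ) : Prop :=
  ∃ h : ℤ × ℤ → ℤ, IsHeightFunctionOn V h ∧ (∀ f ∈ faces V, HasFaceParity h f) ∧ ∀ f ∈ B, h f = ξ f

open scoped Classical in
/-- **`Ω(D, ξ)`**: the arrow configurations of `E(V)` that are the gradient of a height function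
on `D(V)` (parity convention) equal to `ξ` on the support `B`. [cite: DuminilCopinKarrilaManolescuOulamara2024, §1.3] -/
def heightConfigs (V B : Finset (ℤ × ℤ)) (ξ : ℤ × ℤ → ℤ) : Finset (↥(edges V) → Bool) :=
  Finset.univ.filter fun σ => ∃ h : ℤ × ℤ → ℤ,
    IsHeightOf V (EdgeConfig.val σ) h ∧ (∀ f ∈ faces V, HasFaceParity h f) ∧ ∀ f ∈ B, h f = ξ f

open scoped Classical in
/-- **The height function of a configuration** of `Ω(D, ξ)`: a height function on `D(V)` with
the parity convention, equal to `ξ` on `B`, whose gradient is `σ` (DCKMO identify the two: "the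
map from these graph homomorphisms to the associated six-vertex configurations is bijective").
It is obtained by choice among the witnesses and is determined by `σ` and `ξ` on every face joined
to `B` inside `D`; off `Ω(D, ξ)` the junk value `ξ` is returned. [cite: DuminilCopinKarrilaManolescuOulamara2024, §1.3] -/
def heightOf (V B : Finset (ℤ × ℤ)) (ξ : ℤ × ℤ → ℤ) (σ : ↥(edges V) → Bool) : ℤ × ℤ → ℤ :=
  if H : ∃ h : ℤ × ℤ → ℤ, IsHeightOf V (EdgeConfig.val σ) h ∧
      (∀ f ∈ faces V, HasFaceParity h f) ∧ ∀ f ∈ B, h f = ξ f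
  then H.choose else ξ

/-- On `Ω(D, ξ)` the chosen height function has gradient `σ`, the parity convention, and boundary
values `ξ` on `B`. [cite: DuminilCopinKarrilaManolescuOulamara2024, §1.3] -/
theorem heightOf_spec {V B : Finset (ℤ × ℤ)} {ξ : ℤ × ℤ → ℤ} {σ : ↥(edges V) → Bool}
    (hσ : σ ∈ heightConfigs V B ξ) :
    IsHeightOf V (EdgeConfig.val σ) (heightOf V B ξ σ) ∧
      (∀ f ∈ faces V, HasFaceParity (heightOf V B ξ σ) f) ∧ ∀ f ∈ B, heightOf V B ξ σ f = ξ f := by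
  classical
  have H : ∃ h : ℤ × ℤ → ℤ, IsHeightOf V (EdgeConfig.val σ) h ∧
      (∀ f ∈ faces V, HasFaceParity h f) ∧ ∀ f ∈ B, h f = ξ f := (Finset.mem_filter.mp hσ).2
  rw [heightOf, dif_pos H]
  exact H.choose_spec

/-- The six-vertex weight `W(ω) = ∏_{v ∈ V} W(a,b,c)_v(ω)` of a configuration of `E(V)` ("the
six-vertex weight from the vertices of `V(D)`"). [cite: DuminilCopinKarrilaManolescuOulamara2024, §1.3] -/
def weight (a b c : ℝ) (V : Finset (ℤ × ℤ)) (σ : ↥(edges V) → Bool) : ℝ :=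
  ∏ v ∈ V, vertexEntry (fun _ => sixVertexTensor a b c) σ v

/-- The partition function `Z(D, ξ) = ∑_{ω ∈ Ω(D, ξ)} W(ω)`. [cite: DuminilCopinKarrilaManolescuOulamara2024, §1.3] -/
def heightModelZ (a b c : ℝ) (V B : Finset (ℤ × ℤ)) (ξ : ℤ × ℤ → ℤ) : ℝ :=
  ∑ σ ∈ heightConfigs V B ξ, weight a b c V σ

/-- **The six-vertex height-function model `ℙ_D^ξ`** on the discrete domain `D = D(V)` with
boundary condition `ξ` on the support `B` (`B = bdryFaces V` for the printed `ℙ_D^ξ`):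
the measure `∑_{ω ∈ Ω(D,ξ)} (W(ω)/Z(D,ξ)) δ_ω` on arrow configurations of `E(V)` — a probability
measure as soon as `Z(D, ξ) ≠ 0`, e.g. for admissible `ξ` and positive weights
(`isProbabilityMeasure_sixVertexHeightModel`); the zero measure otherwise (junk). Height
functions are recovered from configurations by integrating the gradient from `ξ`. [cite: DuminilCopinKarrilaManolescuOulamara2024, §1.3] -/
def sixVertexHeightModel (a b c : ℝ) (V B : Finset (ℤ × ℤ)) (ξ : ℤ × ℤ → ℤ) :
    Measure (↥(edges V) → Bool) :=
  ∑ σ ∈ heightConfigs V B ξ,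
    ENNReal.ofReal (weight a b c V σ / heightModelZ a b c V B ξ) • Measure.dirac σ

/-! #### Basic properties -/

/-- Nonnegative weights give nonnegative configuration weights. [folklore] -/
theorem weight_nonneg {a b c : ℝ} (ha : 0 ≤ a) (hb : 0 ≤ b) (hc : 0 ≤ c) (V : Finset (ℤ × ℤ))
    (σ : ↥(edges V) → Bool) : 0 ≤ weight a b c V σ :=
  Finset.prod_nonneg fun _ _ => sixVertexTensor_nonneg ha hb hc _ _ _ _

/-- `Z(D, ξ) ≥ 0` for nonnegative weights. [folklore] -/
theorem heightModelZ_nonneg {a b c : ℝ} (ha : 0 ≤ a) (hb : 0 ≤ b) (hc : 0 ≤ c)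
    (V B : Finset (ℤ × ℤ)) (ξ : ℤ × ℤ → ℤ) : 0 ≤ heightModelZ a b c V B ξ :=
  Finset.sum_nonneg fun σ _ => weight_nonneg ha hb hc V σ

/-- **The printed formula** `ℙ_D^ξ[A] = ∑_{ω ∈ Ω(D,ξ) ∩ A} W(ω) / Z(D, ξ)` (nonnegative weights). [cite: DuminilCopinKarrilaManolescuOulamara2024, §1.3] -/
theorem sixVertexHeightModel_real {a b c : ℝ} (ha : 0 ≤ a) (hb : 0 ≤ b) (hc : 0 ≤ c)
    (V B : Finset (ℤ × ℤ)) (ξ : ℤ × ℤ → ℤ) (A : Set (↥(edges V) → Bool)) [DecidablePred (· ∈ A)] :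
    (sixVertexHeightModel a b c V B ξ).real A =
      (∑ σ ∈ (heightConfigs V B ξ).filter (· ∈ A), weight a b c V σ) / heightModelZ a b c V B ξ := by
  have hZ := heightModelZ_nonneg ha hb hc V B ξ
  have hnn : ∀ σ ∈ heightConfigs V B ξ,
      0 ≤ (if σ ∈ A then weight a b c V σ / heightModelZ a b c V B ξ else 0) := fun σ _ => by
    split_ifs
    · exact div_nonneg (weight_nonneg ha hb hc V σ) hZ
    · exact le_rfl
  have hterm : ∀ σ ∈ heightConfigs V B ξ,
      ENNReal.ofReal (weight a b c V σ / heightModelZ a b c V B ξ) * A.indicator 1 σ =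
        ENNReal.ofReal (if σ ∈ A then weight a b c V σ / heightModelZ a b c V B ξ else 0) := by
    intro σ _
    by_cases hσ : σ ∈ A <;> simp [hσ]
  rw [measureReal_def, sixVertexHeightModel, Measure.finsetSum_apply]
  simp only [Measure.smul_apply, Measure.dirac_apply, smul_eq_mul]
  rw [Finset.sum_congr rfl hterm, ← ENNReal.ofReal_sum_of_nonneg hnn,
    ENNReal.toReal_ofReal (Finset.sum_nonneg hnn), Finset.sum_div, Finset.sum_filter]

/-- The four edges at a vertex of `V` are edges of `E(V)`. [folklore] -/
theorem vertexEdges_subset_edges {V : Finset (ℤ × ℤ)} {v : ℤ × ℤ} (hv : v ∈ V) :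
    vertexEdges v ⊆ edges V :=
  fun _ he => mem_edges_of_mem hv he

/-- **Gradients of height functions obey the ice rule**: going around a vertex of `V` the four
height increments cancel, so two arrows enter and two leave. [cite: DuminilCopinKarrilaManolescuOulamara2024, §1.2] -/
theorem inArrows_eq_two_of_isHeightOf {V : Finset (ℤ × ℤ)} {σ : (ℤ × ℤ) × Bool → Bool}
    {h : ℤ × ℤ → ℤ} (hσ : IsHeightOf V σ h) {v : ℤ × ℤ} (hv : v ∈ V) :
    inArrows (σ (v, false)) (σ (v, true)) (σ ((v.1 - 1, v.2), false))
      (σ ((v.1, v.2 - 1), true)) = 2 := by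
  obtain ⟨x, y⟩ := v
  have hE := hσ _ (vertexEdges_subset_edges hv (by simp [vertexEdges] : ((x, y), false) ∈ _))
  have hN := hσ _ (vertexEdges_subset_edges hv (by simp [vertexEdges] : ((x, y), true) ∈ _))
  have hW := hσ _ (vertexEdges_subset_edges hv
    (by simp [vertexEdges] : ((x - 1, y), false) ∈ vertexEdges (x, y)))
  have hS := hσ _ (vertexEdges_subset_edges hv
    (by simp [vertexEdges] : ((x, y - 1), true) ∈ vertexEdges (x, y)))
  simp only at hE hN hW hS ⊢
  cases he : σ ((x, y), false) <;> cases hn : σ ((x, y), true) <;>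
    cases hw : σ ((x - 1, y), false) <;> cases hs : σ ((x, y - 1), true) <;>
    simp [he, hn, hw, hs, leftFace, rightFace, inArrows] at hE hN hW hS ⊢ <;>
    omega

/-- On `Ω(D, ξ)` the weight is positive for positive `a, b, c` (every vertex of `V` satisfies the
ice rule). [cite: DuminilCopinKarrilaManolescuOulamara2024, §1.3] -/
theorem weight_pos_of_mem_heightConfigs {a b c : ℝ} (ha : 0 < a) (hb : 0 < b) (hc : 0 < c)
    {V B : Finset (ℤ × ℤ)} {ξ : ℤ × ℤ → ℤ} {σ : ↥(edges V) → Bool}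
    (hσ : σ ∈ heightConfigs V B ξ) : 0 < weight a b c V σ := by
  classical
  obtain ⟨h, hh, -, -⟩ := (Finset.mem_filter.mp hσ).2
  exact Finset.prod_pos fun v hv => sixVertexTensor_pos ha hb hc (inArrows_eq_two_of_isHeightOf hh hv)

/-- An admissible boundary condition is realised: the arrows of an admissible height function lie
in `Ω(D, ξ)`. [cite: DuminilCopinKarrilaManolescuOulamara2024, §1.3] -/
theorem heightConfigs_nonempty_of_isAdmissible {V B : Finset (ℤ × ℤ)} {ξ : ℤ × ℤ → ℤ}
    (hξ : IsAdmissible V B ξ) : (heightConfigs V B ξ).Nonempty := by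
  classical
  obtain ⟨h, hh, hpar, hB⟩ := hξ
  refine ⟨fun x => arrowsOf h x.1, Finset.mem_filter.mpr ⟨Finset.mem_univ _, h, ?_, hpar, hB⟩⟩
  intro e he
  rw [EdgeConfig.val_of_mem _ he]
  exact hh.isHeightOf_arrowsOf e he

/-- `Z(D, ξ) > 0` for admissible `ξ` and positive weights. [cite: DuminilCopinKarrilaManolescuOulamara2024, §1.3] -/
theorem heightModelZ_pos {a b c : ℝ} (ha : 0 < a) (hb : 0 < b) (hc : 0 < c)
    {V B : Finset (ℤ × ℤ)} {ξ : ℤ × ℤ → ℤ} (hξ : IsAdmissible V B ξ) :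
    0 < heightModelZ a b c V B ξ :=
  Finset.sum_pos (fun _ hσ => weight_pos_of_mem_heightConfigs ha hb hc hσ)
    (heightConfigs_nonempty_of_isAdmissible hξ)

/-- **`ℙ_D^ξ` is a probability measure** for admissible `ξ` and positive weights. [cite: DuminilCopinKarrilaManolescuOulamara2024, §1.3] -/
theorem isProbabilityMeasure_sixVertexHeightModel {a b c : ℝ} (ha : 0 < a) (hb : 0 < b)
    (hc : 0 < c) {V B : Finset (ℤ × ℤ)} {ξ : ℤ × ℤ → ℤ} (hξ : IsAdmissible V B ξ) :
    IsProbabilityMeasure (sixVertexHeightModel a b c V B ξ) := by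
  have hZ := heightModelZ_pos ha hb hc hξ
  refine ⟨?_⟩
  rw [sixVertexHeightModel, Measure.finsetSum_apply]
  simp only [Measure.smul_apply, Measure.dirac_apply_of_mem (Set.mem_univ _), smul_eq_mul, mul_one]
  rw [← ENNReal.ofReal_sum_of_nonneg fun σ _ =>
      div_nonneg (weight_nonneg ha.le hb.le hc.le V σ) hZ.le,
    ← Finset.sum_div, ← heightModelZ, div_self hZ.ne', ENNReal.ofReal_one]

/-- **Bridge to the planar height function of DKLM.** For a planar ice configuration `ω`, the
height function `heightAt ω` (normalised at the origin face) is associated with `ω` on every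
finite domain: the face on the left of each arrow is one unit higher (`heightAt_east`,
`heightAt_north`). [cite: DKLM2026SixVertexGFF, Def. 2.3] -/
theorem isHeightOf_configEquiv_heightAt (ω : Config (ℤ × ℤ)) (hice : ∀ v, IceRuleAt ω v)
    (V : Finset (ℤ × ℤ)) : IsHeightOf V (configEquiv (ℤ × ℤ) ω) (heightAt ω) := by
  rintro ⟨⟨x, y⟩, d⟩ -
  cases d
  · -- horizontal edge `(x, y) → (x+1, y)`: faces `(x, y)` above and `(x, y-1)` below
    have h1 := heightAt_north ω x (y - 1)
    rw [sub_add_cancel] at h1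
    simp only [configEquiv_apply_false, northStep, sub_add_cancel] at h1 ⊢
    cases hb : (ω (x, y)).1 <;> simp only [hb, leftFace, rightFace, Bool.not_false,
      Bool.not_true, if_true, Bool.false_eq_true, if_false] at h1 ⊢ <;> omega
  · -- vertical edge `(x, y) → (x, y+1)`: faces `(x, y)` east and `(x-1, y)` west
    have h1 := heightAt_east ω hice (x - 1) y
    rw [sub_add_cancel] at h1
    simp only [configEquiv_apply_true, eastStep, sub_add_cancel] at h1 ⊢
    cases hb : (ω (x, y)).2 <;> simp only [hb, leftFace, rightFace, Bool.not_false,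
      Bool.not_true, if_true, Bool.false_eq_true, if_false] at h1 ⊢ <;> omega

end HeightModel

end Literature.Probability.LatticeModels.SixVertex

end
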